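import Literature.MathematicalPhysics.KineticTheory.CollisionWindowCompensator
import Literature.MathematicalPhysics.KineticTheory.HardSphereCanonicalTorus
import Literature.MathematicalPhysics.KineticTheory.HardSphereUniformDensityLLN
import Literature.Analysis.FluidPDE.HardSpherePhaseSpaceProofs
import HarnessLib

/-!
# Geometry of the admissible cells of the flat torus

Topic `Literature/MathematicalPhysics/KineticTheory` — companion of `CollisionWindowCompensator.lean` (the `r'`-cells
`Torus.coarseCell r'`, their centres `cellCentre`, the admissible sizes `admissibleCellSize m = 1/(2m)`, the cell
density `cellDensity`).  At an admissible size the `(2m)³` cells indexed by `[-m, m-1]³` are full cubes of Haar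
measure `r'³` tiling `𝕋³` up to a null set; every point is within minimal-image distance `(√3/2) r'` of the centre of
its cell; Riemann sums over the cell centres of a uniformly continuous function approximate its integral; and sums over
particles regroup as sums over cells weighted by the occupation numbers.  This is the bookkeeping behind every
cell-scale law of large numbers of the crux line `Sketch` of `InformationPercolationEngine.CollisionRate`
(stmt-AtomisticToContinuum-13481, stub `stub_mesoscaleRegularityConst`).

* `cellSet r' e` — the cell `{x | coarseCell r' x = e}`; `volume_cellSet_le` — its Haar measure is `≤ r'³`;
* `admissibleCells m` — the index set `[-m, m-1]³`; `ae_coarseCell_mem_admissibleCells` — a.e. point lies in an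
  admissible cell; `volume_real_cellSet_eq` — each admissible cell has measure exactly `r'³`;
* `euclidDist_cellCentre_coarseCell_le_mul` — `d(x, centre of the cell of x) ≤ (√3/2) r'`;
* `abs_sum_mul_sub_integral_le` — `|Σ_e r'³ f(centre e) − ∫ f| ≤ ω` for `f` with `(√3/2) r'`-modulus `ω`;
  `abs_sum_coneKernel_sub_one_le` — the Riemann sum of the cone mollifier over the cell centres is `1 + O(r'/r⁴)`;
* `sum_eq_sum_card_mul`, `inv_mul_sum_eq_sum_cellDensity_mul`, `sum_cellDensity_mul_eq_one` — regrouping particle sums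
  by cells.

## References

* H. Spohn, *Large Scale Dynamics of Interacting Particles* (1991), Part I §2.3 (coarse graining of the torus into
  cells for the law of large numbers of empirical fields).  [Spohn1991]

## Not here

No measure on configurations: the cell-occupancy law of large numbers and large deviations under the canonical
hard-sphere gas are in `CellOccupancyStatics.lean`.
-/

noncomputable section

open scoped BigOperators ENNReal
open Set MeasureTheory Filter
open Literature.Analysis.FluidPDE

namespace Literature.MathematicalPhysics.KineticTheory

/-! ## Cells as subsets of the torus and their volume -/

/-- The `r'`-cell with index `e ∈ ℤ³`: the points of `𝕋³` whose coarse cell is `e`. [folklore] -/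
def cellSet (r' : ℝ) (e : Fin 3 → ℤ) : Set T3 := {x | Torus.coarseCell r' x = e}

/-- Cells are measurable. [folklore] -/
theorem measurableSet_cellSet (r' : ℝ) (e : Fin 3 → ℤ) : MeasurableSet (cellSet r' e) :=
  (Torus.measurable_coarseCell r') (measurableSet_singleton e)

/-- The lifted cell: the half-open box `∏ᵢ [eᵢ r', (eᵢ+1) r')` of `ℝ³`. [folklore] -/
def cellBox (r' : ℝ) (e : Fin 3 → ℤ) : Set E3 := {y | ∀ i, y i ∈ Ico ((e i : ℝ) * r') (((e i : ℝ) + 1) * r')}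

/-- Membership in the lifted cell is the floor condition `⌊yᵢ / r'⌋ = eᵢ` (`0 < r'`). [folklore] -/
theorem mem_cellBox_iff {r' : ℝ} (hr : 0 < r') (e : Fin 3 → ℤ) (y : E3) :
    y ∈ cellBox r' e ↔ ∀ i, ⌊y i / r'⌋ = e i := by
  refine forall_congr' fun i => ?_
  rw [Int.floor_eq_iff, mem_Ico, le_div_iff₀ hr, div_lt_iff₀ hr]

/-- The cell is the preimage of the lifted cell under the symmetric representative (`0 < r'`). [folklore] -/
theorem cellSet_eq_preimage {r' : ℝ} (hr : 0 < r') (e : Fin 3 → ℤ) :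
    cellSet r' e = Torus.reprSym ⁻¹' cellBox r' e := by
  ext x
  simp only [cellSet, mem_setOf_eq, mem_preimage, mem_cellBox_iff hr]
  exact funext_iff

/-- The lifted cell is the preimage of a coordinate box under `WithLp.ofLp`. [folklore] -/
theorem cellBox_eq_preimage (r' : ℝ) (e : Fin 3 → ℤ) :
    cellBox r' e = (WithLp.ofLp : E3 → Fin 3 → ℝ) ⁻¹'
      Set.pi univ (fun i => Ico ((e i : ℝ) * r') (((e i : ℝ) + 1) * r')) := by
  ext y
  simp [cellBox]

/-- The lifted cell is measurable. [folklore] -/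
theorem measurableSet_cellBox (r' : ℝ) (e : Fin 3 → ℤ) : MeasurableSet (cellBox r' e) := by
  rw [cellBox_eq_preimage]
  exact (WithLp.measurable_ofLp 2 _) (MeasurableSet.univ_pi fun _ => measurableSet_Ico)

/-- The lifted cell has Lebesgue measure `r'³` (`0 < r'`). [folklore] -/
theorem volume_cellBox {r' : ℝ} (hr : 0 < r') (e : Fin 3 → ℤ) : volume (cellBox r' e) = ENNReal.ofReal (r' ^ 3) := by
  rw [cellBox_eq_preimage, (PiLp.volume_preserving_ofLp (Fin 3)).measure_preimage
    (MeasurableSet.univ_pi fun _ => measurableSet_Ico).nullMeasurableSet, volume_pi_pi]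
  simp only [Real.volume_Ico, show ∀ i, ((e i : ℝ) + 1) * r' - (e i : ℝ) * r' = r' from fun i => by ring]
  rw [Finset.prod_const, Finset.card_univ, Fintype.card_fin, ← ENNReal.ofReal_pow hr.le]

/-- **Every cell has Haar measure at most `r'³`** (`0 < r'`): its lift lies in a box of volume `r'³`. [folklore] -/
theorem volume_cellSet_le {r' : ℝ} (hr : 0 < r') (e : Fin 3 → ℤ) : volume (cellSet r' e) ≤ ENNReal.ofReal (r' ^ 3) := by
  rw [cellSet_eq_preimage hr, ← Measure.map_apply Torus.measurable_reprSym (measurableSet_cellBox r' e),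
    Torus.map_reprSym_volume, Measure.restrict_apply (measurableSet_cellBox r' e)]
  exact (measure_mono inter_subset_left).trans (volume_cellBox hr e).le

/-- Distinct cells are disjoint (plain form). [folklore] -/
theorem pairwiseDisjoint_cellSet' (r' : ℝ) {e e' : Fin 3 → ℤ} (hne : e ≠ e') : Disjoint (cellSet r' e) (cellSet r' e') := by
  refine disjoint_left.2 fun x hx hx' => hne ?_
  simp only [cellSet, mem_setOf_eq] at hx hx'
  rw [← hx, ← hx']

/-- Real-valued form: `vol(cell e) ≤ r'³`. [folklore] -/
theorem volume_real_cellSet_le {r' : ℝ} (hr : 0 < r') (e : Fin 3 → ℤ) : volume.real (cellSet r' e) ≤ r' ^ 3 := by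
  rw [measureReal_def]
  exact (ENNReal.toReal_mono ENNReal.ofReal_ne_top (volume_cellSet_le hr e)).trans_eq
    (ENNReal.toReal_ofReal (pow_nonneg hr.le 3))

/-- The cells (all indices `e ∈ ℤ³`, any size) partition the torus: `Σ_e vol(cell e) = 1`. [folklore] -/
theorem tsum_volume_cellSet (r' : ℝ) : ∑' e : Fin 3 → ℤ, volume (cellSet r' e) = 1 := by
  rw [← measure_iUnion (fun e e' hne => pairwiseDisjoint_cellSet' r' hne) (measurableSet_cellSet r'),
    show (⋃ e, cellSet r' e) = (univ : Set T3) from eq_univ_of_forall fun x => mem_iUnion.2 ⟨_, rfl⟩, measure_univ]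

/-! ## The admissible cells -/

/-- The index set `[-m, m-1]³` of the ADMISSIBLE CELLS at size `r' = 1/(2m)`: the `(2m)³` full cubes tiling the torus.
[folklore] -/
def admissibleCells (m : ℕ) : Finset (Fin 3 → ℤ) := Fintype.piFinset fun _ => Finset.Ico (-(m : ℤ)) m

/-- Membership in the admissible index set. [folklore] -/
theorem mem_admissibleCells_iff {m : ℕ} {e : Fin 3 → ℤ} : e ∈ admissibleCells m ↔ ∀ i, -(m : ℤ) ≤ e i ∧ e i < m := by
  simp [admissibleCells, Fintype.mem_piFinset]

/-- There are `(2m)³` admissible cells. [folklore] -/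
theorem card_admissibleCells (m : ℕ) : (admissibleCells m).card = (2 * m) ^ 3 := by
  rw [admissibleCells, Fintype.card_piFinset, Finset.prod_const, Finset.card_univ, Fintype.card_fin, Int.card_Ico]
  congr 1
  omega

/-- `(2m)³ · r'³ = 1` at the admissible size (`1 ≤ m`). [folklore] -/
theorem card_admissibleCells_mul_pow {m : ℕ} (hm : 1 ≤ m) :
    ((admissibleCells m).card : ℝ) * admissibleCellSize m ^ 3 = 1 := by
  rw [card_admissibleCells, admissibleCellSize]
  have : (0 : ℝ) < m := by exact_mod_cast hm
  push_cast
  field_simp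

/-- A point none of whose symmetric coordinates is the seam value `1/2` lies in an admissible cell (`1 ≤ m`). [folklore] -/
theorem coarseCell_mem_admissibleCells_of {m : ℕ} (hm : 1 ≤ m) {x : T3} (hx : ∀ i, Torus.reprSym x i ≠ 1 / 2) :
    Torus.coarseCell (admissibleCellSize m) x ∈ admissibleCells m := by
  rw [mem_admissibleCells_iff]
  intro i
  have hmpos : (0 : ℝ) < m := by exact_mod_cast hm
  have hmem := Torus.reprSym_apply_mem_Ioc x i
  have hlt : Torus.reprSym x i < 1 / 2 := lt_of_le_of_ne hmem.2 (hx i)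
  have hq : Torus.reprSym x i / admissibleCellSize m = 2 * m * Torus.reprSym x i := by
    rw [admissibleCellSize, div_inv_eq_mul]; ring
  change -(m : ℤ) ≤ ⌊Torus.reprSym x i / admissibleCellSize m⌋ ∧ ⌊Torus.reprSym x i / admissibleCellSize m⌋ < m
  rw [hq, Int.le_floor, Int.floor_lt]
  push_cast
  constructor <;> nlinarith [hmem.1]

/-- **Almost every point of the torus lies in an admissible cell** (the exceptional set is the seam
`{∃ i, x̃ᵢ = 1/2}`, a finite union of hyperplane sections). [folklore] -/
theorem ae_coarseCell_mem_admissibleCells {m : ℕ} (hm : 1 ≤ m) :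
    ∀ᵐ x ∂(volume : Measure T3), Torus.coarseCell (admissibleCellSize m) x ∈ admissibleCells m := by
  have hnull : ∀ i : Fin 3, volume {x : T3 | Torus.reprSym x i = 1 / 2} = 0 := by
    intro i
    have hH : MeasurableSet {y : E3 | y i = 1 / 2} :=
      measurableSet_eq_fun (by fun_prop) measurable_const
    have h1 : {x : T3 | Torus.reprSym x i = 1 / 2} = Torus.reprSym ⁻¹' {y : E3 | y i = 1 / 2} := rfl
    rw [h1, ← Measure.map_apply Torus.measurable_reprSym hH, Torus.map_reprSym_volume,
      Measure.restrict_apply hH]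
    refine measure_mono_null inter_subset_left ?_
    have h2 : {y : E3 | y i = 1 / 2} = (WithLp.ofLp : E3 → Fin 3 → ℝ) ⁻¹' {f | f i = 1 / 2} := rfl
    rw [h2, (PiLp.volume_preserving_ofLp (Fin 3)).measure_preimage
      ((measurableSet_eq_fun (measurable_pi_apply i) measurable_const).nullMeasurableSet), volume_pi]
    exact Measure.pi_hyperplane _ i _
  have hae : ∀ᵐ x ∂(volume : Measure T3), ∀ i : Fin 3, Torus.reprSym x i ≠ 1 / 2 := by
    rw [ae_all_iff]
    intro i
    rw [ae_iff]
    simpa only [not_not] using hnull i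
  filter_upwards [hae] with x hx
  exact coarseCell_mem_admissibleCells_of hm hx

/-- The admissible cells cover the torus up to a null set. [folklore] -/
theorem biUnion_cellSet_ae_eq_univ {m : ℕ} (hm : 1 ≤ m) :
    (⋃ e ∈ admissibleCells m, cellSet (admissibleCellSize m) e) =ᵐ[(volume : Measure T3)] (univ : Set T3) := by
  rw [ae_eq_univ]
  have h := ae_coarseCell_mem_admissibleCells hm
  rw [ae_iff] at h
  refine measure_mono_null (fun x hx => ?_) h
  simp only [mem_compl_iff, mem_iUnion, cellSet, mem_setOf_eq, exists_prop, not_exists, not_and] at hx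
  simp only [mem_setOf_eq]
  exact fun hmem => hx _ hmem rfl

/-- Distinct cells are disjoint (`PairwiseDisjoint` form). [folklore] -/
theorem pairwiseDisjoint_cellSet (r' : ℝ) (s : Set (Fin 3 → ℤ)) : s.PairwiseDisjoint (cellSet r') :=
  fun _ _ _ _ hne => pairwiseDisjoint_cellSet' r' hne

/-- The Haar measures of the admissible cells sum to `1`. [folklore] -/
theorem sum_volume_real_cellSet {m : ℕ} (hm : 1 ≤ m) :
    ∑ e ∈ admissibleCells m, volume.real (cellSet (admissibleCellSize m) e) = 1 := by
  rw [← measureReal_biUnion_finset ((pairwiseDisjoint_cellSet _ _))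
    (fun e _ => measurableSet_cellSet _ e), measureReal_congr (biUnion_cellSet_ae_eq_univ hm), probReal_univ]

/-- **Each admissible cell has Haar measure exactly `r'³`** (all are `≤ r'³` and the `(2m)³` of them sum to `1`).
[folklore] -/
theorem volume_real_cellSet_eq {m : ℕ} (hm : 1 ≤ m) {e : Fin 3 → ℤ} (he : e ∈ admissibleCells m) :
    volume.real (cellSet (admissibleCellSize m) e) = admissibleCellSize m ^ 3 := by
  have hle : ∀ e' ∈ admissibleCells m, volume.real (cellSet (admissibleCellSize m) e') ≤ admissibleCellSize m ^ 3 :=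
    fun e' _ => volume_real_cellSet_le (admissibleCellSize_pos hm) e'
  have hsum : ∑ e' ∈ admissibleCells m, volume.real (cellSet (admissibleCellSize m) e') =
      ∑ e' ∈ admissibleCells m, admissibleCellSize m ^ 3 := by
    rw [sum_volume_real_cellSet hm, Finset.sum_const, nsmul_eq_mul, card_admissibleCells_mul_pow hm]
  exact (Finset.sum_eq_sum_iff_of_le hle).1 hsum e he

/-! ## Every point is close to the centre of its cell -/

/-- **`d(x, centre of the cell of x) ≤ (√3/2) r'`** for `0 < r' ≤ 1/2` (each symmetric coordinate is within `r'/2` of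
the centre coordinate, and the chart is an isometry at this scale; the sharp form of the bound `≤ r'` of
`CollisionWindowBookkeeping.euclidDist_cellCentre_coarseCell_le`). [folklore] -/
theorem euclidDist_cellCentre_coarseCell_le_mul {r' : ℝ} (hr : 0 < r') (hr2 : r' ≤ 1 / 2) (x : T3) :
    Torus.euclidDist x (cellCentre r' (Torus.coarseCell r' x)) ≤ Real.sqrt 3 / 2 * r' := by
  set p : E3 := Torus.reprSym x with hp
  set q : E3 := WithLp.toLp 2 fun l => (((Torus.coarseCell r' x l : ℤ) : ℝ) + 1 / 2) * r' with hq
  have hcoord : ∀ l, |p l - q l| ≤ r' / 2 := by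
    intro l
    have h1 := Int.floor_le (p l / r')
    have h2 := Int.lt_floor_add_one (p l / r')
    have hc : ((Torus.coarseCell r' x l : ℤ) : ℝ) = (⌊p l / r'⌋ : ℝ) := rfl
    have hql : q l = ((⌊p l / r'⌋ : ℝ) + 1 / 2) * r' := by rw [hq]; simp [hc]
    rw [hql, abs_le]
    rw [le_div_iff₀ hr] at h1
    rw [div_lt_iff₀ hr] at h2
    constructor <;> nlinarith
  have hnorm : ‖p - q‖ ≤ Real.sqrt 3 / 2 * r' := by
    rw [EuclideanSpace.norm_eq]
    have hsum : ∑ i, ‖(p - q).ofLp i‖ ^ 2 ≤ 3 * (r' / 2) ^ 2 := by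
      calc ∑ i, ‖(p - q).ofLp i‖ ^ 2 ≤ ∑ _i : Fin 3, (r' / 2) ^ 2 := Finset.sum_le_sum fun i _ => by
            rw [Real.norm_eq_abs, WithLp.ofLp_sub, Pi.sub_apply, sq_abs]
            have := hcoord i
            rw [abs_le] at this
            nlinarith [this.1, this.2]
        _ = 3 * (r' / 2) ^ 2 := by simp
    calc Real.sqrt (∑ i, ‖(p - q).ofLp i‖ ^ 2) ≤ Real.sqrt (3 * (r' / 2) ^ 2) := Real.sqrt_le_sqrt hsum
      _ = Real.sqrt 3 / 2 * r' := by
          rw [Real.sqrt_mul (by norm_num), Real.sqrt_sq (by positivity)]; ring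
  have hlt : ‖p - q‖ < 1 / 2 := by
    have h3 : Real.sqrt 3 < 2 := by
      rw [show (2 : ℝ) = Real.sqrt 4 by rw [show (4 : ℝ) = 2 ^ 2 by norm_num, Real.sqrt_sq (by norm_num)]]
      exact Real.sqrt_lt_sqrt (by norm_num) (by norm_num)
    calc ‖p - q‖ ≤ Real.sqrt 3 / 2 * r' := hnorm
      _ ≤ Real.sqrt 3 / 2 * (1 / 2) := mul_le_mul_of_nonneg_left hr2 (by positivity)
      _ < 2 / 2 * (1 / 2) := by gcongr
      _ = 1 / 2 := by norm_num
  have hx : x = Literature.Analysis.FunctionSpaces.Torus.proj p := by rw [hp, Torus.proj_reprSym]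
  have hc : cellCentre r' (Torus.coarseCell r' x) = Literature.Analysis.FunctionSpaces.Torus.proj q := rfl
  rw [hc, hx, euclidDist_proj_proj_of_norm_lt hlt]
  exact hnorm

/-- A point of the cell `e` is within `(√3/2) r'` of its centre (`0 < r' ≤ 1/2`). [folklore] -/
theorem euclidDist_cellCentre_le_of_mem {r' : ℝ} (hr : 0 < r') (hr2 : r' ≤ 1 / 2) {e : Fin 3 → ℤ} {x : T3}
    (hx : x ∈ cellSet r' e) : Torus.euclidDist x (cellCentre r' e) ≤ Real.sqrt 3 / 2 * r' := by
  have h := euclidDist_cellCentre_coarseCell_le_mul hr hr2 x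
  rwa [show Torus.coarseCell r' x = e from hx] at h

/-- The admissible size is at most `1/2` (`1 ≤ m`). [folklore] -/
theorem admissibleCellSize_le_half {m : ℕ} (hm : 1 ≤ m) : admissibleCellSize m ≤ 1 / 2 := by
  rw [admissibleCellSize]
  have : (1 : ℝ) ≤ m := by exact_mod_cast hm
  rw [inv_le_comm₀ (by positivity) (by norm_num)]
  linarith

/-- The admissible size is at most `1` (`1 ≤ m`). [folklore] -/
theorem admissibleCellSize_le_one {m : ℕ} (hm : 1 ≤ m) : admissibleCellSize m ≤ 1 :=
  (admissibleCellSize_le_half hm).trans (by norm_num)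

/-! ## Riemann sums over the cell centres -/

/-- **The integral splits over the admissible cells**: `∫ f = Σ_e ∫_{cell e} f`. [folklore] -/
theorem integral_eq_sum_setIntegral_cellSet {m : ℕ} (hm : 1 ≤ m) {E' : Type*} [NormedAddCommGroup E']
    [NormedSpace ℝ E'] {f : T3 → E'} (hf : Integrable f) :
    ∫ x, f x = ∑ e ∈ admissibleCells m, ∫ x in cellSet (admissibleCellSize m) e, f x := by
  rw [← integral_biUnion_finset (admissibleCells m) (fun e _ => measurableSet_cellSet _ e)
    (pairwiseDisjoint_cellSet _ _) (fun _ _ => hf.integrableOn), setIntegral_congr_set (biUnion_cellSet_ae_eq_univ hm),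
    setIntegral_univ]

/-- **Riemann sums over the cell centres**: if `|f x − f y| ≤ ω` whenever `d(x, y) ≤ (√3/2) r'`, then
`|Σ_e r'³ f(centre e) − ∫ f| ≤ ω` (`f` integrable, `1 ≤ m`). [folklore] -/
theorem abs_sum_mul_sub_integral_le {m : ℕ} (hm : 1 ≤ m) {f : T3 → ℝ} (hf : Integrable f) {ω : ℝ}
    (hω : ∀ x y, Torus.euclidDist x y ≤ Real.sqrt 3 / 2 * admissibleCellSize m → |f x - f y| ≤ ω) :
    |∑ e ∈ admissibleCells m, admissibleCellSize m ^ 3 * f (cellCentre (admissibleCellSize m) e) - ∫ x, f x| ≤ ω := by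
  have hr := admissibleCellSize_pos hm
  have hr2 := admissibleCellSize_le_half hm
  have hω0 : 0 ≤ ω := le_trans (abs_nonneg _) (hω 0 0 (by
    rw [show Torus.euclidDist (0 : T3) 0 = 0 by simp]; positivity))
  set r' := admissibleCellSize m with hr'
  rw [integral_eq_sum_setIntegral_cellSet hm hf, ← Finset.sum_sub_distrib]
  have hterm : ∀ e ∈ admissibleCells m,
      |r' ^ 3 * f (cellCentre r' e) - ∫ x in cellSet r' e, f x| ≤ ω * volume.real (cellSet r' e) := by
    intro e he
    haveI : IsFiniteMeasure ((volume : Measure T3).restrict (cellSet r' e)) := inferInstance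
    have hconst : r' ^ 3 * f (cellCentre r' e) = ∫ _ in cellSet r' e, f (cellCentre r' e) := by
      rw [setIntegral_const, smul_eq_mul, volume_real_cellSet_eq hm he]
    rw [hconst, ← integral_sub (integrable_const _) hf.integrableOn]
    have h := norm_setIntegral_le_of_norm_le_const (measure_lt_top volume (cellSet r' e))
      (f := fun x => f (cellCentre r' e) - f x) (C := ω) (s := cellSet r' e) (μ := volume) (fun x hx => by
        rw [Real.norm_eq_abs]
        exact hω _ _ (by rw [Torus.euclidDist_comm]; exact euclidDist_cellCentre_le_of_mem hr hr2 hx))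
    rw [Real.norm_eq_abs] at h
    exact h
  calc |∑ e ∈ admissibleCells m, (r' ^ 3 * f (cellCentre r' e) - ∫ x in cellSet r' e, f x)|
      ≤ ∑ e ∈ admissibleCells m, |r' ^ 3 * f (cellCentre r' e) - ∫ x in cellSet r' e, f x| :=
        Finset.abs_sum_le_sum_abs _ _
    _ ≤ ∑ e ∈ admissibleCells m, ω * volume.real (cellSet r' e) := Finset.sum_le_sum hterm
    _ = ω := by rw [← Finset.mul_sum, sum_volume_real_cellSet hm, mul_one]

/-- The cone mollifier is symmetric. [folklore] -/
theorem coneKernel_comm (r : ℝ) (x y : T3) : coneKernel r x y = coneKernel r y x := by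
  unfold coneKernel
  rw [Torus.euclidDist_comm]

/-- **The Riemann sum of the cone mollifier over the cell centres is `1 + O(r'/r⁴)`**:
`|Σ_e r'³ b_r(centre e, y) − 1| ≤ 3/(πr⁴) · (√3/2) r'` (`0 < r < 1/2`, `1 ≤ m`; total mass `1`, Lipschitz constant
`3/(πr⁴)`). [folklore] -/
theorem abs_sum_coneKernel_sub_one_le {m : ℕ} (hm : 1 ≤ m) {r : ℝ} (hr : 0 < r) (hr2 : r < 1 / 2) (y : T3) :
    |∑ e ∈ admissibleCells m, admissibleCellSize m ^ 3 * coneKernel r (cellCentre (admissibleCellSize m) e) y - 1| ≤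
      3 / (Real.pi * r ^ 4) * (Real.sqrt 3 / 2 * admissibleCellSize m) := by
  have hcont : Continuous fun x : T3 => coneKernel r x y := by
    have hd : Continuous fun x : T3 => Torus.euclidDist x y := by
      simp only [euclidDist_eq_sqrt]; fun_prop
    unfold coneKernel
    fun_prop
  have h := abs_sum_mul_sub_integral_le hm (integrable_of_continuous_T3 hcont)
    (ω := 3 / (Real.pi * r ^ 4) * (Real.sqrt 3 / 2 * admissibleCellSize m)) fun x x' hxx' => by
      rw [coneKernel_comm r x y, coneKernel_comm r x' y]
      exact (abs_coneKernel_sub_le hr y x x').trans (mul_le_mul_of_nonneg_left hxx' (by positivity))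
  rwa [integral_coneKernel hr hr2 y] at h

/-! ## Regrouping particle sums by cells -/

/-- **Sums over particles regroup as sums over cells**: if every particle lies in an admissible cell then
`Σ_j F(c_j) = Σ_{e admissible} #{j : c_j = e} · F(e)`. [folklore] -/
theorem sum_eq_sum_card_mul {N m : ℕ} {c : Fin (N + 1) → (Fin 3 → ℤ)} (hc : ∀ j, c j ∈ admissibleCells m)
    (F : (Fin 3 → ℤ) → ℝ) :
    ∑ j, F (c j) = ∑ e ∈ admissibleCells m, ((Finset.univ.filter fun j : Fin (N + 1) => c j = e).card : ℝ) * F e := by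
  rw [← Finset.sum_fiberwise_of_maps_to (s := Finset.univ) (t := admissibleCells m) (g := c) (fun j _ => hc j)]
  refine Finset.sum_congr rfl fun e _ => ?_
  rw [Finset.sum_congr rfl fun j hj => by rw [(Finset.mem_filter.1 hj).2], Finset.sum_const, nsmul_eq_mul]

/-- The same in terms of the cell density `n_e = #{j : c_j = e}/((N+1) r'³)`:
`(N+1)⁻¹ Σ_j F(c_j) = Σ_e r'³ n_e F(e)` (`r' ≠ 0`). [folklore] -/
theorem inv_mul_sum_eq_sum_cellDensity_mul {N m : ℕ} {r' : ℝ} (hr : r' ≠ 0) {c : Fin (N + 1) → (Fin 3 → ℤ)}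
    (hc : ∀ j, c j ∈ admissibleCells m) (F : (Fin 3 → ℤ) → ℝ) :
    (((N + 1 : ℕ) : ℝ))⁻¹ * ∑ j, F (c j) = ∑ e ∈ admissibleCells m, r' ^ 3 * cellDensity N r' c e * F e := by
  rw [sum_eq_sum_card_mul hc F, Finset.mul_sum]
  refine Finset.sum_congr rfl fun e _ => ?_
  have hN : (((N + 1 : ℕ) : ℝ)) ≠ 0 := by positivity
  unfold cellDensity
  field_simp

/-- In particular `Σ_e r'³ n_e = 1` when every particle lies in an admissible cell (`r' ≠ 0`). [folklore] -/
theorem sum_cellDensity_mul_eq_one {N m : ℕ} {r' : ℝ} (hr : r' ≠ 0) {c : Fin (N + 1) → (Fin 3 → ℤ)}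
    (hc : ∀ j, c j ∈ admissibleCells m) : ∑ e ∈ admissibleCells m, r' ^ 3 * cellDensity N r' c e = 1 := by
  have h := inv_mul_sum_eq_sum_cellDensity_mul hr hc fun _ => 1
  simp only [mul_one, Finset.sum_const, Finset.card_univ, Fintype.card_fin, nsmul_eq_mul] at h
  rw [← h, inv_mul_cancel₀ (by positivity)]

/-- A cell that is not admissible carries no particle when every particle lies in an admissible cell. [folklore] -/
theorem cellDensity_eq_zero_of_not_mem {N m : ℕ} (r' : ℝ) {c : Fin (N + 1) → (Fin 3 → ℤ)}
    (hc : ∀ j, c j ∈ admissibleCells m) {e : Fin 3 → ℤ} (he : e ∉ admissibleCells m) : cellDensity N r' c e = 0 := by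
  unfold cellDensity
  rw [Finset.card_eq_zero.2, Nat.cast_zero, zero_div]
  refine Finset.filter_eq_empty_iff.2 fun j _ hj => he ?_
  rw [← hj]; exact hc j

/-- The cell density is nonnegative (`0 ≤ r'`). [folklore] -/
theorem cellDensity_nonneg (N : ℕ) {r' : ℝ} (hr : 0 ≤ r') (c : Fin (N + 1) → (Fin 3 → ℤ)) (e : Fin 3 → ℤ) :
    0 ≤ cellDensity N r' c e := by
  unfold cellDensity; positivity

/-- The occupation number of the cell of particle `i` in terms of the cell density:
`#{j : c_j = c_i} = (N+1) r'³ n_{c_i}` (`r' ≠ 0`). [folklore] -/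
theorem card_filter_eq_mul_cellDensity (N : ℕ) {r' : ℝ} (hr : r' ≠ 0) (c : Fin (N + 1) → (Fin 3 → ℤ)) (e : Fin 3 → ℤ) :
    ((Finset.univ.filter fun j : Fin (N + 1) => c j = e).card : ℝ) = ((N + 1 : ℕ) : ℝ) * r' ^ 3 * cellDensity N r' c e := by
  have hN : (((N + 1 : ℕ) : ℝ)) ≠ 0 := by positivity
  unfold cellDensity
  field_simp

end Literature.MathematicalPhysics.KineticTheory

end
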